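import Summits.Parity.BatemanHorn.Theorems.RoughValueTransportRoughValueLawSieveBand
import Literature.NumberTheory.Sieve.HeathBrownCubicFLSequencesA
import HarnessLib

/-!
# Route `RoughParitySectors`, crux `OddSectorShareLinear` (stmt-Parity-15629), line `birth`:
# helpers I for the stub `stub_sieveDecouplingPrime` — the local structure of the decoupling sieve

`--supports stmt-Parity-15629`.  The stub S'a sifts the `k − 1` members `fᵢ`, `i ≠ m`, out of the
sequence `𝒜 = {1 ≤ n ≤ x : f_m(n) prime ≥ z}` by the primes `p < z = ⌈x^{1/U}⌉`, removing the classes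
`Ω p = {c mod p : p ∤ f_m(c), ∃ i ≠ m, p ∣ fᵢ(c)}`; the density is `g(p) = #Ω p/#Φ p`,
`Φ p = {c mod p : p ∤ f_m(c)}`.  This file records, for an arbitrary Bateman–Horn system `f`:

* the fibre dictionary of a sifted sequence indexed by the values of an encoding `N` over an
  arbitrary finite base set `T` (`sum_a_filter_eq`, `congrSum_eq`, `sifted_eq`; the base set
  `Icc 1 X` of `IntervalResidueClassSieve.lean` replaced by `T`);
* the Chinese-remainder split of `#{n ∈ T : n mod q ∈ Ω q ∀ q ∣ d}` over the classes `c mod d`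
  (`card_filter_forall_mem_eq_sum`, `card_classes_eq_prod`);
* `Ω p ⊊ Φ p ⊆ range p`, `#Ω p ≤ ∑ deg fᵢ`, `p ≤ #Φ p + ∑ deg fᵢ` (no fixed prime divisor, Lagrange),
  whence the density `g` has sieve dimension `2S` (`exists_hasSieveDimension`,
  from `CubicSieve.hasSieveDimension_of_le_div`);
* for a linear member `f_m = αX + β`: `#Φ p = p` if `p ∣ α`, `p − 1` otherwise (`card_Φ_eq`), and
  `φ(αd) = φ(α) ∏_{p ∣ d} #Φ p` for squarefree `d` (`totient_mul_eq`).
-/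

noncomputable section

open Finset Polynomial
open scoped BigOperators
open Literature.NumberTheory.Sieve

namespace Summit.Parity.BatemanHorn.Cruxes.OddSectorShareLinear.Birth

namespace SieveDecoupling

/-! ### Fibre dictionary for a sequence indexed by the values of an encoding -/

/-- Fibre count: if `a_v = #{n ∈ T : N(n) = v}` and `0 < N ≤ B`, then summing the weights over the
`v ≤ B` with `C v` counts the `n ∈ T` with `C (N n)` (as `IntervalClassSieve.sum_a_filter_eq`, base
set `T`). [folklore] -/
theorem sum_a_filter_eq {A : SieveSequence} {T : Finset ℕ} {B : ℕ} {N : ℕ → ℕ}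
    (ha : ∀ v, A.a v = (#{n ∈ T | N n = v} : ℝ)) (hN0 : ∀ n, 0 < N n)
    (hNB : ∀ n, N n ≤ B) (C : ℕ → Prop) [DecidablePred C] :
    ∑ v ∈ (Ioc 0 B).filter C, A.a v = #{n ∈ T | C (N n)} := by
  -- adapted from `Literature.NumberTheory.Sieve.IntervalClassSieve.sum_a_filter_eq`
  simp only [ha]
  rw [← Nat.cast_sum, Nat.cast_inj]
  rw [Finset.card_eq_sum_card_fiberwise (f := N) (s := {n ∈ T | C (N n)})
    (t := (Ioc 0 B).filter C) ?_]
  · refine Finset.sum_congr rfl fun v hv => ?_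
    have hCv : C v := (Finset.mem_filter.mp hv).2
    congr 1
    ext n
    simp only [Finset.mem_filter]
    constructor
    · rintro ⟨h1, h3⟩
      exact ⟨⟨h1, by rw [h3]; exact hCv⟩, h3⟩
    · rintro ⟨⟨h1, _⟩, h3⟩
      exact ⟨h1, h3⟩
  · intro n hn
    have hn' : n ∈ {n ∈ T | C (N n)} := hn
    rw [Finset.mem_filter] at hn'
    show N n ∈ (Ioc 0 B).filter C
    rw [Finset.mem_filter, Finset.mem_Ioc]
    exact ⟨⟨hN0 n, hNB n⟩, hn'.2⟩

/-- The congruence sums count the `n ∈ T` with `d ∣ N(n)`. [folklore] -/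
theorem congrSum_eq {A : SieveSequence} {T : Finset ℕ} {B : ℕ} {N : ℕ → ℕ}
    (ha : ∀ v, A.a v = (#{n ∈ T | N n = v} : ℝ)) (hN0 : ∀ n, 0 < N n)
    (hNB : ∀ n, N n ≤ B) (d : ℕ) : A.congrSum d B = #{n ∈ T | d ∣ N n} := by
  rw [SieveSequence.congrSum, Nat.floor_natCast]
  exact sum_a_filter_eq ha hN0 hNB (d ∣ ·)

/-- The sifting function counts the `n ∈ T` with `(N(n), P) = 1`. [folklore] -/
theorem sifted_eq {A : SieveSequence} {T : Finset ℕ} {B : ℕ} {N : ℕ → ℕ}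
    (ha : ∀ v, A.a v = (#{n ∈ T | N n = v} : ℝ)) (hN0 : ∀ n, 0 < N n)
    (hNB : ∀ n, N n ≤ B) (P : ℕ) : A.sifted B P = #{n ∈ T | (N n).Coprime P} := by
  rw [SieveSequence.sifted, Nat.floor_natCast]
  exact sum_a_filter_eq ha hN0 hNB (fun v => v.Coprime P)

/-! ### The Chinese-remainder split over the classes modulo `d` -/

/-- `#{n ∈ T : n mod q ∈ Ω q ∀ q ∣ d prime} = Σ_{c mod d admissible} #{n ∈ T : n ≡ c (d)}`. [folklore] -/
theorem card_filter_forall_mem_eq_sum (T : Finset ℕ) (Ω : ℕ → Finset ℕ) {d : ℕ} (hd : d ≠ 0) :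
    #{n ∈ T | ∀ q ∈ d.primeFactors, n % q ∈ Ω q} =
      ∑ c ∈ (range d).filter (fun c => ∀ q ∈ d.primeFactors, c % q ∈ Ω q),
        #{n ∈ T | n % d = c} := by
  rw [Finset.card_eq_sum_card_fiberwise (f := fun n => n % d)
    (s := {n ∈ T | ∀ q ∈ d.primeFactors, n % q ∈ Ω q})
    (t := (range d).filter (fun c => ∀ q ∈ d.primeFactors, c % q ∈ Ω q)) ?_]
  · refine Finset.sum_congr rfl fun c hc => ?_
    rw [Finset.mem_filter] at hc
    congr 1
    ext n
    simp only [Finset.mem_filter]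
    constructor
    · rintro ⟨⟨hT, -⟩, hmod⟩
      exact ⟨hT, hmod⟩
    · rintro ⟨hT, hmod⟩
      refine ⟨⟨hT, fun q hq => ?_⟩, hmod⟩
      rw [← Nat.mod_mod_of_dvd n (Nat.dvd_of_mem_primeFactors hq), hmod]
      exact hc.2 q hq
  · intro n hn
    have hn' : n ∈ {n ∈ T | ∀ q ∈ d.primeFactors, n % q ∈ Ω q} := hn
    rw [Finset.mem_filter] at hn'
    show n % d ∈ (range d).filter (fun c => ∀ q ∈ d.primeFactors, c % q ∈ Ω q)
    rw [Finset.mem_filter, Finset.mem_range]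
    refine ⟨Nat.mod_lt n (Nat.pos_of_ne_zero hd), fun q hq => ?_⟩
    rw [Nat.mod_mod_of_dvd n (Nat.dvd_of_mem_primeFactors hq)]
    exact hn'.2 q hq

/-- The admissible classes modulo a squarefree `d` number `∏_{q ∣ d} #Ω q` (Chinese remainder,
`Lichtman2020.card_filter_range_prod_eq_prod_card`). [folklore] -/
theorem card_classes_eq_prod (Ω : ℕ → Finset ℕ) (hΩ : ∀ p : ℕ, p.Prime → ∀ r ∈ Ω p, r < p)
    {d : ℕ} (hd : Squarefree d) :
    #((range d).filter (fun c => ∀ q ∈ d.primeFactors, c % q ∈ Ω q)) =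
      ∏ q ∈ d.primeFactors, #(Ω q) := by
  have h := Lichtman2020.card_filter_range_prod_eq_prod_card d.primeFactors
    (fun q hq => Nat.prime_of_mem_primeFactors hq) Ω
    (fun q hq => hΩ q (Nat.prime_of_mem_primeFactors hq))
  rw [Nat.prod_primeFactors_of_squarefree hd] at h
  exact h

/-- The admissible classes modulo `d` are at most `d` in number. [folklore] -/
theorem card_classes_le (Ω : ℕ → Finset ℕ) (d : ℕ) :
    #((range d).filter (fun c => ∀ q ∈ d.primeFactors, c % q ∈ Ω q)) ≤ d :=
  (card_filter_le _ _).trans (card_range d).le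

/-! ### The local structure `Ω p ⊊ Φ p` of a Bateman–Horn system at the member `m` -/

variable {k : ℕ} {f : Fin k → ℤ[X]} {m : Fin k} {Ω Φ : ℕ → Finset ℕ}

/-- `Ω p ⊆ range p`. [folklore] -/
theorem lt_of_mem_Ω
    (hΩ : ∀ p, Ω p = (range p).filter (fun c : ℕ => ¬ ((p : ℤ) ∣ (f m).eval (c : ℤ)) ∧
      ∃ i, i ≠ m ∧ (p : ℤ) ∣ (f i).eval (c : ℤ)))
    (p : ℕ) : ∀ r ∈ Ω p, r < p := fun r hr => by
  rw [hΩ, mem_filter, mem_range] at hr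
  exact hr.1

/-- `Ω p ⊆ Φ p`. [folklore] -/
theorem Ω_subset_Φ
    (hΩ : ∀ p, Ω p = (range p).filter (fun c : ℕ => ¬ ((p : ℤ) ∣ (f m).eval (c : ℤ)) ∧
      ∃ i, i ≠ m ∧ (p : ℤ) ∣ (f i).eval (c : ℤ)))
    (hΦ : ∀ p, Φ p = (range p).filter (fun c : ℕ => ¬ ((p : ℤ) ∣ (f m).eval (c : ℤ))))
    (p : ℕ) : Ω p ⊆ Φ p := fun c hc => by
  rw [hΩ, mem_filter] at hc
  rw [hΦ, mem_filter]
  exact ⟨hc.1, hc.2.1⟩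

/-- `#Φ p ≤ p`. [folklore] -/
theorem card_Φ_le
    (hΦ : ∀ p, Φ p = (range p).filter (fun c : ℕ => ¬ ((p : ℤ) ∣ (f m).eval (c : ℤ))))
    (p : ℕ) : #(Φ p) ≤ p := by
  rw [hΦ]
  exact (card_filter_le _ _).trans (card_range p).le

/-- `#Ω p ≤ ∑ deg fᵢ` at every prime (Lagrange, `SieveBand.card_classes_le_sum`). [folklore] -/
theorem card_Ω_le (hf : IsBatemanHornSystem f)
    (hΩ : ∀ p, Ω p = (range p).filter (fun c : ℕ => ¬ ((p : ℤ) ∣ (f m).eval (c : ℤ)) ∧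
      ∃ i, i ≠ m ∧ (p : ℤ) ∣ (f i).eval (c : ℤ)))
    {p : ℕ} (hp : p.Prime) : #(Ω p) ≤ ∑ i, (f i).natDegree := by
  rw [hΩ]
  refine le_trans (card_le_card fun c hc => ?_)
    (RoughValueLaw.IncrementAnchoring.SieveBand.card_classes_le_sum hf hp (fun i => i ≠ m))
  rw [mem_filter] at hc ⊢
  exact ⟨hc.1, hc.2.2⟩

/-- `p ≤ #Φ p + ∑ deg fᵢ` at every prime: the complement of `Φ p` consists of roots of `f_m`. [folklore] -/
theorem le_card_Φ_add (hf : IsBatemanHornSystem f)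
    (hΦ : ∀ p, Φ p = (range p).filter (fun c : ℕ => ¬ ((p : ℤ) ∣ (f m).eval (c : ℤ))))
    {p : ℕ} (hp : p.Prime) : p ≤ #(Φ p) + ∑ i, (f i).natDegree := by
  have h1 := RoughValueLaw.IncrementAnchoring.SieveBand.card_classes_le_sum hf hp (fun i => i = m)
  have h2 : #((range p).filter (fun c : ℕ => (p : ℤ) ∣ (f m).eval (c : ℤ))) ≤
      #((range p).filter fun r : ℕ => ∃ i, i = m ∧ (p : ℤ) ∣ (f i).eval (r : ℤ)) :=
    card_le_card fun c hc => by
      rw [mem_filter] at hc ⊢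
      exact ⟨hc.1, m, rfl, hc.2⟩
  have h3 := Finset.card_filter_add_card_filter_not (s := range p)
    (fun c : ℕ => (p : ℤ) ∣ (f m).eval (c : ℤ))
  rw [card_range, ← hΦ] at h3
  omega

/-- `#Ω p < #Φ p` at every prime: a class `c₀` with `p ∤ ∏ fᵢ(c₀)` (no fixed prime divisor) lies in
`Φ p` but not in `Ω p`. [folklore] -/
theorem card_Ω_lt_card_Φ (hf : IsBatemanHornSystem f)
    (hΩ : ∀ p, Ω p = (range p).filter (fun c : ℕ => ¬ ((p : ℤ) ∣ (f m).eval (c : ℤ)) ∧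
      ∃ i, i ≠ m ∧ (p : ℤ) ∣ (f i).eval (c : ℤ)))
    (hΦ : ∀ p, Φ p = (range p).filter (fun c : ℕ => ¬ ((p : ℤ) ∣ (f m).eval (c : ℤ))))
    {p : ℕ} (hp : p.Prime) : #(Ω p) < #(Φ p) := by
  have hlt := hf.hasNoFixedPrimeDivisor p hp
  unfold polyRootCountMod at hlt
  obtain ⟨c₀, hc₀, hnot⟩ : ∃ c₀ ∈ range p, ¬ ((p : ℤ) ∣ ∏ i, (f i).eval (c₀ : ℤ)) := by
    by_contra h
    push Not at h
    have : #((range p).filter fun n : ℕ => (p : ℤ) ∣ ∏ i, (f i).eval (n : ℤ)) = p := by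
      rw [filter_true_of_mem h, card_range]
    omega
  refine Finset.card_lt_card ((Finset.ssubset_iff_of_subset (Ω_subset_Φ hΩ hΦ p)).mpr
    ⟨c₀, ?_, fun hc₀Ω => ?_⟩)
  · rw [hΦ, mem_filter]
    exact ⟨hc₀, fun hdvd => hnot (hdvd.trans (Finset.dvd_prod_of_mem _ (mem_univ m)))⟩
  · rw [hΩ, mem_filter] at hc₀Ω
    obtain ⟨-, -, i, -, hi⟩ := hc₀Ω
    exact hnot (hi.trans (Finset.dvd_prod_of_mem _ (mem_univ i)))

/-- **The density `g(p) = #Ω p/#Φ p` has sieve dimension `2S`** (`S ≥ ∑ deg fᵢ`, `S ≥ 1`):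
`0 ≤ g(p) ≤ 2S/p` and `g(p) ≤ 1 − 1/(4S)` (`CubicSieve.hasSieveDimension_of_le_div`). [folklore] -/
theorem exists_hasSieveDimension (hf : IsBatemanHornSystem f)
    (hΩ : ∀ p, Ω p = (range p).filter (fun c : ℕ => ¬ ((p : ℤ) ∣ (f m).eval (c : ℤ)) ∧
      ∃ i, i ≠ m ∧ (p : ℤ) ∣ (f i).eval (c : ℤ)))
    (hΦ : ∀ p, Φ p = (range p).filter (fun c : ℕ => ¬ ((p : ℤ) ∣ (f m).eval (c : ℤ))))
    {g : ArithmeticFunction ℝ} (hgp : ∀ p : ℕ, p.Prime → g p = (#(Ω p) : ℝ) / (#(Φ p) : ℝ))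
    {S : ℕ} (hS : ∑ i, (f i).natDegree ≤ S) (hS1 : 1 ≤ S) :
    ∃ K : ℝ, HasSieveDimension g ((2 * S : ℕ) : ℝ) K := by
  have hδ : (0 : ℝ) < 1 / (4 * S) := by positivity
  refine ⟨_, CubicSieve.hasSieveDimension_of_le_div (A := 2 * S) hδ fun p hp => ?_⟩
  have hΩΦ := card_Ω_lt_card_Φ hf hΩ hΦ hp
  have hΦp : (#(Φ p) : ℝ) ≤ p := by exact_mod_cast card_Φ_le hΦ p
  have hΩS : (#(Ω p) : ℝ) ≤ S := by exact_mod_cast (card_Ω_le hf hΩ hp).trans hS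
  have hΦS : (p : ℝ) ≤ #(Φ p) + S := by
    exact_mod_cast (le_card_Φ_add hf hΦ hp).trans (Nat.add_le_add_left hS _)
  have hΩΦ' : (#(Ω p) : ℝ) + 1 ≤ #(Φ p) := by exact_mod_cast hΩΦ
  have hΦpos : (0 : ℝ) < #(Φ p) := by linarith [Nat.cast_nonneg (α := ℝ) (#(Ω p))]
  have hp0 : (0 : ℝ) < p := by exact_mod_cast hp.pos
  have hS0 : (1 : ℝ) ≤ S := by exact_mod_cast hS1
  have hΩ0 : (0 : ℝ) ≤ #(Ω p) := Nat.cast_nonneg _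
  rw [hgp p hp]
  have hA : (#(Ω p) : ℝ) / #(Φ p) ≤ ((2 * S : ℕ) : ℝ) / p := by
    rw [div_le_div_iff₀ hΦpos hp0]
    push_cast
    by_cases h2 : (p : ℝ) ≤ 2 * S
    · nlinarith
    · push Not at h2
      nlinarith
  have hB : (#(Ω p) : ℝ) / #(Φ p) ≤ 1 - 1 / #(Φ p) := by
    rw [div_le_iff₀ hΦpos, sub_mul, one_mul, div_mul_cancel₀ _ hΦpos.ne']
    linarith
  refine ⟨by positivity, hA, ?_⟩
  by_cases h4 : (p : ℝ) ≤ 4 * S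
  · have : 1 / (4 * (S : ℝ)) ≤ 1 / #(Φ p) :=
      one_div_le_one_div_of_le hΦpos (hΦp.trans h4)
    linarith
  · push Not at h4
    have h5 : ((2 * S : ℕ) : ℝ) / p ≤ 1 / 2 := by
      rw [div_le_iff₀ hp0]
      push_cast
      linarith
    have h6 : 1 / (4 * (S : ℝ)) ≤ 1 / 4 := one_div_le_one_div_of_le (by norm_num) (by linarith)
    linarith

/-! ### A linear member: `#Φ p` and `φ(αd)` -/

/-- For `f_m = αX + β` (`α ≥ 1`, no prime divides both `α` and `β`): `#Φ p = p` if `p ∣ α` and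
`#Φ p = p − 1` if `p ∤ α` (`αc + β ≡ 0 (p)` has no, resp. exactly one, solution `c mod p`). [folklore] -/
theorem card_Φ_eq
    (hΦ : ∀ p, Φ p = (range p).filter (fun c : ℕ => ¬ ((p : ℤ) ∣ (f m).eval (c : ℤ))))
    {α β : ℤ} (hα : 0 < α) (hfm : ∀ n : ℤ, (f m).eval n = α * n + β)
    (hαβ : ∀ p : ℕ, p.Prime → (p : ℤ) ∣ α → ¬ ((p : ℤ) ∣ β)) {p : ℕ} (hp : p.Prime) :
    #(Φ p) = if p ∣ α.toNat then p else p - 1 := by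
  haveI := Fact.mk hp
  have hαZ : ((α.toNat : ℕ) : ℤ) = α := Int.toNat_of_nonneg hα.le
  have hdvdα : p ∣ α.toNat ↔ (p : ℤ) ∣ α := by rw [← Int.natCast_dvd_natCast, hαZ]
  have hcast : ∀ c : ℕ, ((p : ℤ) ∣ α * c + β) ↔ ((α : ZMod p) * (c : ZMod p) + (β : ZMod p) = 0) := by
    intro c
    rw [← ZMod.intCast_zmod_eq_zero_iff_dvd]
    push_cast
    rfl
  have hroots : #((range p).filter (fun c : ℕ => (p : ℤ) ∣ (f m).eval (c : ℤ))) =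
      if p ∣ α.toNat then 0 else 1 := by
    have e : (range p).filter (fun c : ℕ => (p : ℤ) ∣ (f m).eval (c : ℤ)) =
        (range p).filter (fun c : ℕ => (α : ZMod p) * (c : ZMod p) + (β : ZMod p) = 0) :=
      filter_congr fun c _ => by rw [hfm, hcast]
    rw [e]
    split_ifs with hpa
    · rw [card_eq_zero, filter_eq_empty_iff]
      intro c _ h0
      have hα0 : (α : ZMod p) = 0 := (ZMod.intCast_zmod_eq_zero_iff_dvd α p).mpr (hdvdα.mp hpa)
      rw [hα0, zero_mul, zero_add, ZMod.intCast_zmod_eq_zero_iff_dvd] at h0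
      exact hαβ p hp (hdvdα.mp hpa) h0
    · have hα0 : (α : ZMod p) ≠ 0 := by
        rw [Ne, ZMod.intCast_zmod_eq_zero_iff_dvd]; exact fun h => hpa (hdvdα.mpr h)
      rw [card_eq_one]
      refine ⟨((α : ZMod p)⁻¹ * -(β : ZMod p)).val, ?_⟩
      ext c
      rw [mem_filter, mem_range, mem_singleton]
      constructor
      · rintro ⟨hc, h0⟩
        have h1 : (c : ZMod p) = (α : ZMod p)⁻¹ * -(β : ZMod p) := by
          rw [← eq_neg_of_add_eq_zero_left h0, ← mul_assoc, inv_mul_cancel₀ hα0, one_mul]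
        rw [← ZMod.val_cast_of_lt hc, h1]
      · rintro rfl
        refine ⟨ZMod.val_lt _, ?_⟩
        rw [ZMod.natCast_zmod_val, ← mul_assoc, mul_inv_cancel₀ hα0, one_mul, neg_add_cancel]
  have h3 := Finset.card_filter_add_card_filter_not (s := range p)
    (fun c : ℕ => (p : ℤ) ∣ (f m).eval (c : ℤ))
  rw [card_range, ← hΦ, hroots] at h3
  split_ifs at h3 ⊢ <;> omega

/-- `φ(a ∏_{p ∈ s} p) = φ(a) ∏_{p ∈ s} (p if p ∣ a, p − 1 if p ∤ a)` for a finite set `s` of primes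
(`Nat.totient_mul_of_prime_of_dvd`, `Nat.totient_mul_of_prime_of_not_dvd`). [folklore] -/
theorem totient_mul_prod_eq (a : ℕ) : ∀ s : Finset ℕ, (∀ p ∈ s, p.Prime) →
    (a * ∏ p ∈ s, p).totient = a.totient * ∏ p ∈ s, (if p ∣ a then p else p - 1) := by
  intro s
  induction s using Finset.induction_on with
  | empty => intro; simp
  | insert p s hps ih =>
    intro hs
    have hp : p.Prime := hs p (mem_insert_self p s)
    have hs' : ∀ q ∈ s, q.Prime := fun q hq => hs q (mem_insert_of_mem hq)
    have hiff : p ∣ a * ∏ q ∈ s, q ↔ p ∣ a := by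
      refine ⟨fun h => ?_, fun h => h.mul_right _⟩
      rcases (Nat.Prime.dvd_mul hp).mp h with h | h
      · exact h
      · obtain ⟨q, hq, hpq⟩ := (Prime.dvd_finsetProd_iff hp.prime _).mp h
        have := (Nat.prime_dvd_prime_iff_eq hp (hs' q hq)).mp hpq
        exact absurd hq (this ▸ hps)
    rw [prod_insert hps, prod_insert hps, mul_left_comm]
    by_cases hpa : p ∣ a
    · rw [if_pos hpa, Nat.totient_mul_of_prime_of_dvd hp (hiff.mpr hpa), ih hs']; ring
    · rw [if_neg hpa, Nat.totient_mul_of_prime_of_not_dvd hp (fun h => hpa (hiff.mp h)), ih hs']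
      ring

/-- **`φ(αd) = φ(α) ∏_{p ∣ d} #Φ p`** for squarefree `d` and the linear member `f_m = αX + β`. [folklore] -/
theorem totient_mul_eq
    (hΦ : ∀ p, Φ p = (range p).filter (fun c : ℕ => ¬ ((p : ℤ) ∣ (f m).eval (c : ℤ))))
    {α β : ℤ} (hα : 0 < α) (hfm : ∀ n : ℤ, (f m).eval n = α * n + β)
    (hαβ : ∀ p : ℕ, p.Prime → (p : ℤ) ∣ α → ¬ ((p : ℤ) ∣ β)) {d : ℕ} (hd : Squarefree d) :
    (((α.toNat * d).totient : ℕ) : ℝ) = ((α.toNat).totient : ℝ) * ∏ p ∈ d.primeFactors, (#(Φ p) : ℝ) := by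
  have h := totient_mul_prod_eq α.toNat d.primeFactors (fun p hp => Nat.prime_of_mem_primeFactors hp)
  rw [Nat.prod_primeFactors_of_squarefree hd] at h
  rw [h, Nat.cast_mul, Nat.cast_prod]
  refine congrArg _ (prod_congr rfl fun p hp => ?_)
  rw [card_Φ_eq hΦ hα hfm hαβ (Nat.prime_of_mem_primeFactors hp)]

/-! ### `ω` and prime factors -/

/-- `ω(n) = #(prime factors of n)`. [folklore] -/
theorem cardDistinctFactors_eq_card (n : ℕ) :
    ArithmeticFunction.cardDistinctFactors n = #n.primeFactors := by
  rw [ArithmeticFunction.cardDistinctFactors_apply, ← Nat.toFinset_factors, List.card_toFinset]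

/-- `ω(d) ≤ ω(ad)` for `a ≠ 0`. [folklore] -/
theorem cardDistinctFactors_le_mul {a : ℕ} (ha : a ≠ 0) (d : ℕ) :
    ArithmeticFunction.cardDistinctFactors d ≤ ArithmeticFunction.cardDistinctFactors (a * d) := by
  rcases Nat.eq_zero_or_pos d with rfl | hd
  · simp
  rw [cardDistinctFactors_eq_card, cardDistinctFactors_eq_card]
  exact card_le_card (Nat.primeFactors_mono (dvd_mul_left d a) (Nat.mul_ne_zero ha hd.ne'))

/-- With at most `S` classes per prime, `∏_{q ∣ d} #Ω q ≤ S^{ω(d)}`. [folklore] -/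
theorem prod_card_le_pow (Ω : ℕ → Finset ℕ) {S : ℕ} (hS : ∀ p : ℕ, p.Prime → #(Ω p) ≤ S) (d : ℕ) :
    ∏ q ∈ d.primeFactors, #(Ω q) ≤ S ^ ArithmeticFunction.cardDistinctFactors d := by
  rw [cardDistinctFactors_eq_card, ← prod_const]
  exact prod_le_prod' fun q hq => hS q (Nat.prime_of_mem_primeFactors hq)

end SieveDecoupling

/-- **Sub-goal (dimension of the decoupling density)** of the stub `stub_sieveDecouplingPrime`
(crux stmt-Parity-15629, line `birth`): for a Bateman–Horn system `f`, a member `m` and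
`S ≥ max(1, ∑ deg fᵢ)`, the conditional density `g(p) = #{c : p ∤ f_m(c), ∃ i ≠ m, p ∣ fᵢ(c)}/#{c : p ∤ f_m(c)}`
has sieve dimension `2S` for some constant (`SieveDecoupling.exists_hasSieveDimension`). [folklore] -/
theorem stub_decouplingDensityDimension :
    ∀ (k : ℕ) (f : Fin k → Polynomial ℤ), Literature.NumberTheory.Sieve.IsBatemanHornSystem f →
    ∀ (m : Fin k) (g : ArithmeticFunction ℝ), (∀ p : ℕ, p.Prime → g p = ((((Finset.range p).filter
    (fun c : ℕ => ¬ ((p : ℤ) ∣ (f m).eval (c : ℤ)) ∧ ∃ i, i ≠ m ∧ (p : ℤ) ∣ (f i).eval (c :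
    ℤ))).card : ℕ) : ℝ) / ((((Finset.range p).filter (fun c : ℕ => ¬ ((p : ℤ) ∣ (f m).eval (c :
    ℤ)))).card : ℕ) : ℝ)) → ∀ S : ℕ, (∑ i, (f i).natDegree) ≤ S → 1 ≤ S → ∃ K : ℝ,
    Literature.NumberTheory.Sieve.HasSieveDimension g ((2 * S : ℕ) : ℝ) K := by
  intro k f hf m g hg S hS hS1
  exact SieveDecoupling.exists_hasSieveDimension hf (m := m)
    (Ω := fun p => (Finset.range p).filter (fun c : ℕ => ¬ ((p : ℤ) ∣ (f m).eval (c : ℤ)) ∧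
      ∃ i, i ≠ m ∧ (p : ℤ) ∣ (f i).eval (c : ℤ)))
    (Φ := fun p => (Finset.range p).filter (fun c : ℕ => ¬ ((p : ℤ) ∣ (f m).eval (c : ℤ))))
    (fun _ => rfl) (fun _ => rfl) hg hS hS1

end Summit.Parity.BatemanHorn.Cruxes.OddSectorShareLinear.Birth

end
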